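import Summits.QuantumFields.YangMills.Theorems.UnitScaleTiltProp7ChartRealitySplit
import Summits.QuantumFields.YangMills.Theorems.UnitScaleTiltProp7CmapTwSymInputs
import Summits.QuantumFields.YangMills.Theorems.UnitScaleTiltProp7Chart48SymUntwisted
import Summits.QuantumFields.YangMills.Theorems.UnitScaleTiltProp7SymFrameUnitary
import Summits.QuantumFields.YangMills.Theorems.UnitScaleTiltProp7DbarTwSymUnitary
import HarnessLib

/-!
# `UnitScaleTiltProp7ChartRealityTwS` — (R) REALITY-S: **THE RE-BASED TWISTED LOG-CHART `A ↦ log U̿ˢ(A)` IS `𝔰𝔲(2)`-VALUED ON `𝔰𝔲(2)`-VALUED EXPONENTS INSIDE ITS BALL,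
# HENCE PRINT's (51) «for A′ with values in 𝔤 the configuration D(A′) has values in 𝔤» FOR THE S CHART** — the chart-specific input of ★w2-19200 g3's frame-free reality plumbing
# ✓p614799 `Prop7ChartRealitySplit` (its «HONEST SCOPE: the chart-specific input … stays to be supplied»), with that plumbing re-run BALL-LOCALLY (the twisted average and `mlog` are
# `𝔰𝔲(2)`-valued only inside their windows, not on the whole real subspace)
# (route `UnitScaleTilt`, crux K1 «MinimiserStabilityRegPr» stmt-QuantumFields-19200, stub `stub_existenceMinimalOrbit` (EX), route (α), the reality third of the displayed row `hXtw″ˢ`;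
# def-free, count-neutral)

Cell `ym3-torus` (HUMAN RULING D-0037, YM ladder rung R3 — YM₃ on T³ is a rung, not d = 4, not a mass gap, not Clay), width seat `ym-ust-20520-w4` (gen 3); ★w2-19200 g3's listed split
candidate (a) of `hXtw″` («REALITY row», bus 07:52:22Z), taken by this seat (bus 09:2xZ).

THE PRINT.  [Balaban1985Variational] p. 286, (51): «We consider configurations A′, X with values in the complexified Lie algebra 𝔤ᶜ … for A′ with values in 𝔤 the configuration D(A′)
has values in 𝔤 also.»  [Balaban1985BackgroundPropagators] p. 393, (3.13)–(3.14): «(1/η_j)Q_j(U, ηA) = Q_j(U)A + C_j(U, A) … C_j(U, A) is an analytic function of A» — for unitary data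
the function (3.13) (= `log` of the twisted average) is `𝔤`-valued.  [Balaban1987RG1] (0.9) p. 253: the exp-mean-log average of `SU(N)` data near `1` is in `SU(N)`.

WHAT IS PROVED (sorry-free, no definition; `M₂ = Matrix (Fin 2) (Fin 2) ℂ`, `L²`-operator norm; «`𝔰𝔲(2)`-valued» is spelled `star (Y c) = -Y c ∧ (Y c).trace = 0` bondwise, no new letter):
* §1 (frame-free, ball-local twins of ✓p614799's three lemmas) ★`fderiv_apply_mem_of_mapsTo_of_ball`, `remainder_mem_of_mapsTo_of_ball`, ★★`chartExponent_mem_of_mapsTo_of_ball` — the chart `f`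
  is asked to map the real fields `S` into the closed real data `S′` only on the ball `‖y‖ < R` of the remainder's `QuadAnalytic` radius; `Dfix_mem_of_invariant` is run on the closed
  invariant `S′ ∩ B̄(0, 4C₂ε²)` (kept by `B13Contraction113.mapsTo_T`), where the chart is only evaluated at `‖A′ − HX‖ < 2ε ≤ R`.
* §2 `star_mlog_eq_neg_and_trace_zero_of_su2` (`log` of `SU(2)` within `⅓` of `1` is skew-Hermitian traceless — lit `ExpMeanLog.star_mlog_eq_neg` + `trace_mlog_eq_zero`, `2·⅓ < π`),
  `ninth_budget`, ★`logChartTwS_skewHermitian_of_mem` (at a bond where `U̿ˢ(A)(c) ∈ SU(2)` and `‖U̿ˢ(A)(c) − 1‖ ≤ ⅓`), ★★`logChartTwS_skewHermitian_of_ball` (the window from W3 ✓p617963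
  `norm_dbarTwS_sub_one_le`: `‖U̿ˢ − 1‖ ≤ 3(2e + 2700Lε₀) ≤ ⅓` under `10⁹L²e ≤ 1`, `10¹²L³ε₀ ≤ 1`; the `SU(2)`-valuedness of `U̿ˢ(A)(c)` DISPLAYED as `hSU`).
* §3 ★`dbarTwS_mem_specialUnitaryUnits_of_frames` — `U̿ˢ(iX)(c) ∈ SU(2)` from: frames `∈ SU(2)` (displayed `hSU`, exactly ★w5-20520 g4's witness-file letter), descended fields
  `∈ SU(2)` (✓p609764 `descendToGL_bgUnits_mem_specialUnitaryUnits_of_regPr` at `U₀ ∈ 𝔘_k(ε₀)` and at `e^{iX}U₀ ∈ 𝔘_k(ε₁)` via ✓`unitsField_toUField_emb15_expHermField`);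
  ★★`dbarTwS_mem_specialUnitaryUnits_of_regPr₂` — the same with `hSU` DISCHARGED by ★w3-20520 g4's ✓p620309 `Prop7SymFrameBound.frameTwS_mem_specialUnitaryUnits_of_regPr`
  (`‖X(b)‖ ≤ e·η`, `10⁹L²e ≤ 1`, `10¹²L³ε₀ ≤ 1`); ★★`logChartTwS_skewHermitian_of_regPr₂` — hence `log U̿ˢ(iX)(c) ∈ 𝔰𝔲(2)` at the knit's exponents, NO displayed `SU(2)` letter.
* §4 ★★★**`chartExponentTwS_mem_of_ball`** — for the S chart of record (`f := logChartTwS U₀`, `f′(0) = QTwS U₀`, `C = CmapTwS U₀`; `HasFDerivAt` from W5 ✓p618880 `analyticOnNhd_logChartTwS`):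
  for ANY closed real data space `S′` containing the `𝔰𝔲(2)`-valued data, ANY real field space `S`, ANY `ℂ`-linear `H` with `H(S′) ⊆ S`, inside print's contraction
  regime (`QuadAnalytic (CmapTwS U₀) C₂ R`, `R ≤ e·η`, `‖HX‖ ≤ b‖X‖`, `9C₂bε < 1`, `3ε ≤ R`) and under the DISPLAYED tower clause `hSUball : ∀ A ∈ S, ‖A‖ < R → ∀ c, U̿ˢ(A)(c) ∈ SU(2)`:
  every real `A′` with `‖A′‖ < ε` has `Dfix (CmapTwS U₀) H C₂ A′ ∈ S′` and **`A′ − H(Dfix (CmapTwS U₀) H C₂ A′) ∈ S`** — the reality third of `hXtw″ˢ`.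
* §5 (v1.1) ★★`dbarTwS_mem_specialUnitaryUnits_of_skewHermitian` (the tower clause at `X := −i·A`, ★w3-20520 g4's ✓`Prop7SymFrameBound.dbarTwS_mem_specialUnitaryUnits_of_regPr`) and
  ★★★**`chartExponentTwS_mem_of_ball_of_regPr`** — §4 with `hSUball` SUPPLIED: no displayed `SU(2)` letter; only the opaque `H`'s reality `hH` remains.
HONEST FRAMING.  Plumbing + the `SU(2)`/`log` algebra; in §2–§4 the `SU(2)`-valuedness of the frames ∕ of the twisted average is displayed (`hSU`, `hSUball`), in §3b∕§5 it is
supplied by ★w3-20520 g4's `…SymFrameUnitary` ∕ `…DbarTwSymUnitary`; the reality of the opaque `H` stays displayed (`hH`); nothing of print's estimates is asserted; the stub EX, the crux and the gap are NOT claimed.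
`--supports stmt-QuantumFields-19200 --as helper`.

References: T. Bałaban, CMP 102 (1985) 277–309 [Balaban1985Variational] ((44)–(51) pp.285–286, (55) p.286, Prop. 3 p.289, (112) p.294); CMP 99 (1985) 389–434 [Balaban1985BackgroundPropagators]
((3.13)–(3.14) p.393); CMP 109 (1987) 249–301 [Balaban1987RG1] ((0.9) p.253); CMP 98 (1985) 17–51 [Balaban1985Averaging] ((89)–(92) p.31); CMP 99 (1985) 75–102 [Balaban1985RegularSpaces]
((1.31) p.82).
-/

set_option autoImplicit false

noncomputable section

open Metric Set Filter Topology
open scoped Matrix.Norms.L2Operator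

namespace Summit.QuantumFields.YangMills.Theorems.Prop7ChartRealityTwS

open Literature.MathematicalPhysics.QuantumFieldTheory.Balaban1983to89
open Literature.MathematicalPhysics.QuantumFieldTheory.Balaban1983to89.T3ContinuumYM3Torus
open B13Contraction113 (QuadAnalytic mapsTo_T)
open B11Prop3Model (Dfix)
open T3PrintedRegularMinimiser (RegPr)
open T3SectALandauChart (eta eta_pos bgUnits emb15)
open B7Prop1Explicit (expUnit)
open B7Prop2SpecialUnitary (specialUnitaryUnits mem_specialUnitaryUnits)
open B10Eq27TorusAxialLog (unitsField toUField)
open MatrixLog (mlog)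
open ExpMeanLog (star_mlog_eq_neg trace_mlog_eq_zero)
open Summit.QuantumFields.YangMills.Theorems.Prop7DfixInvariant (Dfix_mem_of_invariant)
open Summit.QuantumFields.YangMills.Theorems.Prop7TPrint (expHermField)
open Summit.QuantumFields.YangMills.Theorems.Prop7SymAvgGL (descendToGL)
open Summit.QuantumFields.YangMills.Theorems.Prop7SymAvgGLSmallOfRegPr (bgUnits_eq)
open Summit.QuantumFields.YangMills.Theorems.Prop7SymAvgTwSym (frameTwS dbarTwS logChartTwS QTwS CmapTwS dbarTwS_def logChartTwS_apply logChartTwS_zero QTwS_def)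
open Summit.QuantumFields.YangMills.Theorems.Prop7Chart48SymUntwisted (unitsField_toUField_emb15_expHermField)
open Summit.QuantumFields.YangMills.Theorems.Prop7DbarTwWindow (descendToGL_bgUnits_mem_specialUnitaryUnits_of_regPr)
open Summit.QuantumFields.YangMills.Theorems.Prop7DbarTwSymWindow (norm_dbarTwS_sub_one_le windows_of_numerals)
open Summit.QuantumFields.YangMills.Theorems.Prop7SymFrameBound (frameTwS_mem_specialUnitaryUnits_of_regPr)
open Summit.QuantumFields.YangMills.Theorems.Prop7CmapTwSymInputs (analyticOnNhd_logChartTwS)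

section FrameFree

variable {E F : Type*} [NormedAddCommGroup E] [NormedSpace ℂ E] [NormedAddCommGroup F] [NormedSpace ℂ F]

/-! ## §1 Ball-local versions of the frame-free reality lemmas of `Prop7ChartRealitySplit` -/

/-- ★ **THE DERIVATIVE AT `0` OF A MAP SENDING `S ∩ B(0,ρ)` INTO THE CLOSED `S′` SENDS `S` INTO `S′`** — the ball-local form of
`Prop7ChartRealitySplit.fderiv_apply_mem_of_mapsTo`: only the slopes `t⁻¹·f(tv)` with `‖tv‖ < ρ` are used. [cite: Balaban1985Variational, (51) p.286; Balaban1985BackgroundPropagators, (3.14) p.393] -/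
theorem fderiv_apply_mem_of_mapsTo_of_ball {f : E → F} {f' : E →L[ℂ] F} (hf : HasFDerivAt f f' 0) (hf0 : f 0 = 0)
    (S : Submodule ℝ E) (S' : Submodule ℝ F) (hS' : IsClosed (S' : Set F)) {ρ : ℝ} (hρ : 0 < ρ)
    (hmaps : ∀ y ∈ S, ‖y‖ < ρ → f y ∈ S') {v : E} (hv : v ∈ S) :
    f' v ∈ S' := by
  -- the line `t ↦ f (t • v)` has derivative `f′ v` at `0`
  have hℓ : HasDerivAt (fun t : ℝ => t • v) v 0 := by
    simpa using (hasDerivAt_id (0:ℝ)).smul_const v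
  have hf'' : HasFDerivAt f (f'.restrictScalars ℝ) ((fun t : ℝ => t • v) 0) := by
    simp only [zero_smul]; exact hf.restrictScalars ℝ
  have hg : HasDerivAt (fun t : ℝ => f (t • v)) (f' v) 0 := by
    have h : HasDerivAt (f ∘ fun t : ℝ => t • v) ((f'.restrictScalars ℝ) v) 0 := hf''.comp_hasDerivAt (0:ℝ) hℓ
    exact h
  -- its slopes at small `t` lie in `S′`
  refine hS'.mem_of_tendsto hg.tendsto_slope_zero ?_
  have hsmall : ∀ᶠ t : ℝ in 𝓝[≠] 0, ‖t • v‖ < ρ := by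
    have hcont : Tendsto (fun t : ℝ => ‖t • v‖) (𝓝 0) (𝓝 0) := by
      have h := ((continuous_id.smul continuous_const).norm : Continuous fun t : ℝ => ‖t • v‖).tendsto 0
      simpa using h
    exact eventually_nhdsWithin_of_eventually_nhds (hcont.eventually (gt_mem_nhds hρ))
  filter_upwards [hsmall] with t ht
  have h1 : f (((0:ℝ) + t) • v) ∈ S' := by
    rw [zero_add]; exact hmaps _ (S.smul_mem _ hv) ht
  have h2 : f ((0:ℝ) • v) ∈ S' := by rw [zero_smul, hf0]; exact S'.zero_mem
  exact S'.smul_mem _ (S'.sub_mem h1 h2)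

/-- **THE REMAINDER `C = f − f′(0)` SENDS `S ∩ B(0,ρ)` INTO `S′`** (ball-local form of `Prop7ChartRealitySplit.remainder_mem_of_mapsTo`).
[cite: Balaban1985BackgroundPropagators, (3.14) p.393; Balaban1985Variational, (44) p.285, (51) p.286] -/
theorem remainder_mem_of_mapsTo_of_ball {f : E → F} {f' : E →L[ℂ] F} (hf : HasFDerivAt f f' 0) (hf0 : f 0 = 0)
    (S : Submodule ℝ E) (S' : Submodule ℝ F) (hS' : IsClosed (S' : Set F)) {ρ : ℝ} (hρ : 0 < ρ)
    (hmaps : ∀ y ∈ S, ‖y‖ < ρ → f y ∈ S') {v : E} (hv : v ∈ S) (hvρ : ‖v‖ < ρ) :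
    f v - f' v ∈ S' :=
  S'.sub_mem (hmaps v hv hvρ) (fderiv_apply_mem_of_mapsTo_of_ball hf hf0 S S' hS' hρ hmaps hv)

/-! ## §2 The chart exponent is real for real `A′` — reality of the chart needed only on the analyticity ball `‖·‖ < R` -/

/-- ★★ **PRINT'S (51) WITH BALL-LOCAL REALITY OF THE CHART**: as `Prop7ChartRealitySplit.chartExponent_mem_of_mapsTo`, but the chart `f` is asked to map `S` into `S′`
only on the ball `‖y‖ < R` of its remainder's `QuadAnalytic` radius (`3ε ≤ R`) — the contraction (52) evaluates `C` only at `A′ − HX` with `‖X‖ ≤ 4C₂ε²`, where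
`‖A′ − HX‖ ≤ ε + 4C₂bε·ε < 2ε ≤ R` (`9C₂bε < 1`); `Dfix_mem_of_invariant` is run on the closed invariant `S′ ∩ B̄(0, 4C₂ε²)` (kept by `mapsTo_T`).  Conclusion:
`Dfix C H C₂ A′ ∈ S′` and `A′ − H(Dfix C H C₂ A′) ∈ S`. [cite: Balaban1985Variational, (47)–(55) pp.285–286, Prop. 3 p.289, (112) p.294] -/
theorem chartExponent_mem_of_mapsTo_of_ball [CompleteSpace F] {f : E → F} {f' : E →L[ℂ] F} (hf : HasFDerivAt f f' 0) (hf0 : f 0 = 0)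
    (S : Submodule ℝ E) (S' : Submodule ℝ F) (hS' : IsClosed (S' : Set F))
    {H : F →ₗ[ℂ] E} (hH : ∀ X ∈ S', H X ∈ S)
    {C₂ R b ε : ℝ} (hmaps : ∀ y ∈ S, ‖y‖ < R → f y ∈ S')
    (hC : QuadAnalytic (fun A => f A - f' A) C₂ R) (hC₂ : 0 ≤ C₂) (hb : 0 ≤ b) (hHop : ∀ X, ‖H X‖ ≤ b * ‖X‖)
    (hq : 9 * C₂ * b * ε < 1) (hRC : 3 * ε ≤ R) {A : E} (hAε : ‖A‖ < ε) (hA : A ∈ S) :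
    Dfix (fun A => f A - f' A) H C₂ A ∈ S' ∧ A - H (Dfix (fun A => f A - f' A) H C₂ A) ∈ S := by
  have hε : 0 < ε := (norm_nonneg _).trans_lt hAε
  have hR : 0 < R := by linarith
  have hK0 : 0 ≤ 9 * C₂ * b * ε := by positivity
  have hR2 : 4 * C₂ * b * ε ≤ 1 := by nlinarith
  have hRC2 : 2 * ε ≤ R := by linarith
  -- the argument `A − HX` stays in the reality ball for `‖X‖ ≤ 4C₂ε²`
  have harg : ∀ X : F, ‖X‖ ≤ 4 * C₂ * ε ^ 2 → ‖A - H X‖ < R := fun X hX => by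
    have h1 : ‖A - H X‖ ≤ ‖A‖ + b * ‖X‖ := (norm_sub_le _ _).trans (add_le_add le_rfl (hHop X))
    have h2 : b * ‖X‖ ≤ b * (4 * C₂ * ε ^ 2) := mul_le_mul_of_nonneg_left hX hb
    have h3 : b * (4 * C₂ * ε ^ 2) = (4 * C₂ * b * ε) * ε := by ring
    have h4 : (4 * C₂ * b * ε) * ε ≤ 1 * ε := mul_le_mul_of_nonneg_right hR2 hε.le
    linarith
  -- `Dfix` lies in the closed invariant `S′ ∩ B̄(0, 4C₂ε²)`
  have hmapsT : MapsTo (fun X => (fun A => f A - f' A) (A - H X)) (closedBall (0:F) (4 * C₂ * ε ^ 2)) (closedBall (0:F) (4 * C₂ * ε ^ 2)) :=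
    mapsTo_T hC hC₂ hb hHop hAε hR2 hRC2
  have hD : Dfix (fun A => f A - f' A) H C₂ A ∈ ((S' : Set F) ∩ closedBall (0:F) (4 * C₂ * ε ^ 2)) := by
    refine Dfix_mem_of_invariant hC hC₂ hb hHop hq hRC hAε (hS'.inter isClosed_closedBall)
      ⟨S'.zero_mem, by simp only [mem_closedBall, dist_zero_right, norm_zero]; positivity⟩ ?_
    rintro X ⟨hXS, hXb⟩
    refine ⟨?_, hmapsT hXb⟩
    have hXn : ‖X‖ ≤ 4 * C₂ * ε ^ 2 := by simpa only [mem_closedBall, dist_zero_right] using hXb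
    exact remainder_mem_of_mapsTo_of_ball hf hf0 S S' hS' hR hmaps (S.sub_mem hA (hH X hXS)) (harg X hXn)
  exact ⟨hD.1, S.sub_mem hA (hH _ hD.1)⟩


end FrameFree

/-! ## §2 `log` of `SU(2)` near `1` is `𝔰𝔲(2)`-valued; the twisted log-chart at a bond -/

/-- **`log W` IS SKEW-HERMITIAN AND TRACELESS for `W ∈ SU(2)` with `‖W − 1‖ ≤ ⅓`** (`(log W)* = log W* = log W⁻¹ = −log W`; `e^{tr log W} = det W = 1` and `|tr log W| ≤ 2·2‖W − 1‖ < 2π`).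
[cite: Balaban1987RG1, (0.9) p.253] -/
theorem star_mlog_eq_neg_and_trace_zero_of_su2 {W : Matrix (Fin 2) (Fin 2) ℂ} (hW : W ∈ Matrix.specialUnitaryGroup (Fin 2) ℂ) (h13 : ‖W - 1‖ ≤ 1 / 3) :
    star (mlog W) = -mlog W ∧ (mlog W).trace = 0 := by
  refine ⟨star_mlog_eq_neg (Matrix.mem_specialUnitaryGroup_iff.1 hW).1 h13, trace_mlog_eq_zero hW h13 ?_⟩
  have h2 : (Fintype.card (Fin 2) : ℝ) = 2 := by simp
  rw [h2]
  nlinarith [Real.pi_gt_three, norm_nonneg (W - 1)]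

variable (F : T3Family) {n K : ℕ} (h : n ≤ K)

/-- **THE BUDGET**: `10⁹L²e ≤ 1` and `10¹²L³ε₀ ≤ 1` give `3(2e + 2700Lε₀) ≤ ⅓` (`L ≥ 3`). [cite: Balaban1985Variational, (6) p.278] -/
theorem ninth_budget {ε₀ e : ℝ} (hε₀ : 0 ≤ ε₀) (he : 0 ≤ e) (hWe : 10 ^ 9 * (F.L : ℝ) ^ 2 * e ≤ 1) (hWε : 10 ^ 12 * (F.L : ℝ) ^ 3 * ε₀ ≤ 1) :
    3 * (2 * e + 2700 * (F.L : ℝ) * ε₀) ≤ 1 / 3 := by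
  have hL3 : 3 ≤ F.L := by obtain ⟨a, ha⟩ := F.hL.1; have := F.hL.2; omega
  have hL3r : (3 : ℝ) ≤ F.L := by exact_mod_cast hL3
  have h9 : (9 : ℝ) ≤ (F.L : ℝ) ^ 2 := by nlinarith
  have hL13 : (F.L : ℝ) ≤ (F.L : ℝ) ^ 3 := by nlinarith
  have ha : (F.L : ℝ) * ε₀ ≤ (F.L : ℝ) ^ 3 * ε₀ := mul_le_mul_of_nonneg_right hL13 hε₀
  have hee : (0:ℝ) ≤ 9 * e := mul_nonneg (by norm_num : (0:ℝ) ≤ 9) he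
  nlinarith [hee]

/-- ★ **THE TWISTED LOG-CHART AT A BOND IS `𝔰𝔲(2)`-VALUED** where the re-based twisted average is `SU(2)`-valued and within `⅓` of `1`: `(log U̿ˢ(A)(c))* = −log U̿ˢ(A)(c)`, `tr = 0`.
[cite: Balaban1985BackgroundPropagators, (3.13) p.393; Balaban1987RG1, (0.9) p.253] -/
theorem logChartTwS_skewHermitian_of_mem (U₀ : GaugeField (F.P K) 0 (Matrix.specialUnitaryGroup (Fin 2) ℂ)) (A : PBond (F.P K) 0 → Matrix (Fin 2) (Fin 2) ℂ) (c : PBond (F.P n) 0)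
    (hSU : dbarTwS F n K h U₀ A c ∈ specialUnitaryUnits (Fin 2))
    (h13 : ‖((dbarTwS F n K h U₀ A c : (Matrix (Fin 2) (Fin 2) ℂ)ˣ) : Matrix (Fin 2) (Fin 2) ℂ) - 1‖ ≤ 1 / 3) :
    star (logChartTwS F n K h U₀ A c) = -logChartTwS F n K h U₀ A c ∧ (logChartTwS F n K h U₀ A c).trace = 0 := by
  rw [logChartTwS_apply]
  exact star_mlog_eq_neg_and_trace_zero_of_su2 (mem_specialUnitaryUnits.1 hSU) h13

/-- ★★ **THE TWISTED LOG-CHART IS `𝔰𝔲(2)`-VALUED ON THE BALL `‖A(b)‖ ≤ e·η`** at a printed-regular background, under the L-only numerals `10⁹L²e ≤ 1`, `10¹²L³ε₀ ≤ 1` (the window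
`‖U̿ˢ(A) − 1‖ ≤ 3(2e + 2700Lε₀) ≤ ⅓` is W3 ✓p617963), the `SU(2)`-valuedness of `U̿ˢ(A)(c)` DISPLAYED (`hSU`; supplier: the symmetric frames and the two towers are `SU(2)`-valued —
★w3-20520 g4's `…SymFrameUnitary`). [cite: Balaban1985Variational, (51) p.286; Balaban1985BackgroundPropagators, (3.13)–(3.14) p.393] -/
theorem logChartTwS_skewHermitian_of_ball {ε₀ e : ℝ} (hε₀ : 0 < ε₀) (he : 0 ≤ e) (hWe : 10 ^ 9 * (F.L : ℝ) ^ 2 * e ≤ 1) (hWε : 10 ^ 12 * (F.L : ℝ) ^ 3 * ε₀ ≤ 1)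
    (U₀ : GaugeField (F.P K) 0 (Matrix.specialUnitaryGroup (Fin 2) ℂ)) (hreg : RegPr F n K ε₀ U₀)
    (A : PBond (F.P K) 0 → Matrix (Fin 2) (Fin 2) ℂ) (hA : ∀ b, ‖A b‖ ≤ e * eta F n K)
    (hSU : ∀ c : PBond (F.P n) 0, dbarTwS F n K h U₀ A c ∈ specialUnitaryUnits (Fin 2)) (c : PBond (F.P n) 0) :
    star (logChartTwS F n K h U₀ A c) = -logChartTwS F n K h U₀ A c ∧ (logChartTwS F n K h U₀ A c).trace = 0 :=
  logChartTwS_skewHermitian_of_mem F h U₀ A c (hSU c)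
    ((norm_dbarTwS_sub_one_le F h hε₀ he hWe hWε U₀ hreg A hA c).1.trans (ninth_budget F hε₀.le he hWe hWε))

/-! ## §3 `U̿ˢ(iX)(c) ∈ SU(2)` from `SU(2)`-valued frames and the two printed-regular descents -/

/-- ★ **THE RE-BASED TWISTED AVERAGE IS `SU(2)`-VALUED** at `A = iX`, `X` Hermitian traceless, when `U₀ ∈ 𝔘_k(ε₀)` and `e^{iX}U₀ ∈ 𝔘_k(ε₁)` (`10⁷L³·max(ε₀, ε₁) ≤ 1`: both
descents are the `SU(2)` ones, ✓p609764) and the symmetric frames are `SU(2)`-valued (DISPLAYED `hSU` — ★w5-20520 g4's witness-file letter; supplier ★w3-20520 g4):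
`U̿ˢ = w(c₋)⁻¹·D̄(e^{iX}U₀)(c)·w(c₊)·D̄(U₀)(c)⁻¹ ∈ SU(2)`. [cite: Balaban1985Averaging, (89)–(92) p.31; Balaban1985RegularSpaces, (1.30)–(1.31) pp.81–82] -/
theorem dbarTwS_mem_specialUnitaryUnits_of_frames {ε₀ ε₁ : ℝ} (hε₀ : 0 < ε₀) (hε₀' : 10 ^ 7 * (F.L : ℝ) ^ 3 * ε₀ ≤ 1)
    (hε₁ : 0 < ε₁) (hε₁' : 10 ^ 7 * (F.L : ℝ) ^ 3 * ε₁ ≤ 1)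
    {U₀ : GaugeField (F.P K) 0 (Matrix.specialUnitaryGroup (Fin 2) ℂ)} (hU₀ : RegPr F n K ε₀ U₀)
    {X : PBond (F.P K) 0 → Matrix (Fin 2) (Fin 2) ℂ} (hX : ∀ b : PBond (F.P K) 0, (X b).IsHermitian ∧ Matrix.trace (X b) = 0)
    (hU₁ : RegPr F n K ε₁ (emb15 U₀ (expHermField X)))
    (hSU : ∀ y : Site (F.P n) 0, frameTwS F n K h U₀ (fun b => Complex.I • X b) y ∈ specialUnitaryUnits (Fin 2)) (c : PBond (F.P n) 0) :
    dbarTwS F n K h U₀ (fun b => Complex.I • X b) c ∈ specialUnitaryUnits (Fin 2) := by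
  have h1 : descendToGL F n K h (fun b => expUnit (Complex.I • X b) * bgUnits F K U₀ b) c ∈ specialUnitaryUnits (Fin 2) := by
    rw [← unitsField_toUField_emb15_expHermField F U₀ X hX, ← bgUnits_eq F K (emb15 U₀ (expHermField X))]
    exact descendToGL_bgUnits_mem_specialUnitaryUnits_of_regPr F h hε₁ hε₁' _ hU₁ c
  have h0 := descendToGL_bgUnits_mem_specialUnitaryUnits_of_regPr F h hε₀ hε₀' U₀ hU₀ c
  rw [dbarTwS_def]
  exact Subgroup.mul_mem _ (Subgroup.mul_mem _ (Subgroup.mul_mem _ (Subgroup.inv_mem _ (hSU c.src)) h1) (hSU c.tgt)) (Subgroup.inv_mem _ h0)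

/-- ★★ **THE RE-BASED TWISTED AVERAGE `U̿ˢ(iX)(c)` IS `SU(2)`-VALUED, FRAMES DISCHARGED**: as `dbarTwS_mem_specialUnitaryUnits_of_frames` with `hSU` supplied by ★w3-20520 g4's
✓p620309 `Prop7SymFrameBound.frameTwS_mem_specialUnitaryUnits_of_regPr` (the symmetric accumulated frames are `SU(2)`-valued at `U₀ ∈ 𝔘_k(ε₀)`, `‖X(b)‖ ≤ e·η`, `10⁹L²e ≤ 1`,
`10¹²L³ε₀ ≤ 1`); the perturbed descent still reads `e^{iX}U₀ ∈ 𝔘_k(ε₁)` (`10⁷L³ε₁ ≤ 1`) — the knit's (19) ⇒ (1.39) row ([Balaban1985RegularSpaces] Prop. 7) supplies it.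
[cite: Balaban1985Averaging, (89)–(92) p.31; Balaban1985RegularSpaces, (1.30)–(1.31) pp.81–82, Prop. 7 p.100; Balaban1987RG1, (0.9) p.253] -/
theorem dbarTwS_mem_specialUnitaryUnits_of_regPr₂ {ε₀ ε₁ e : ℝ} (hε₀ : 0 < ε₀) (he : 0 ≤ e) (hWe : 10 ^ 9 * (F.L : ℝ) ^ 2 * e ≤ 1) (hWε : 10 ^ 12 * (F.L : ℝ) ^ 3 * ε₀ ≤ 1)
    (hε₁ : 0 < ε₁) (hε₁' : 10 ^ 7 * (F.L : ℝ) ^ 3 * ε₁ ≤ 1)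
    {U₀ : GaugeField (F.P K) 0 (Matrix.specialUnitaryGroup (Fin 2) ℂ)} (hU₀ : RegPr F n K ε₀ U₀)
    {X : PBond (F.P K) 0 → Matrix (Fin 2) (Fin 2) ℂ} (hX : ∀ b : PBond (F.P K) 0, (X b).IsHermitian ∧ Matrix.trace (X b) = 0) (hXe : ∀ b, ‖X b‖ ≤ e * eta F n K)
    (hU₁ : RegPr F n K ε₁ (emb15 U₀ (expHermField X))) (c : PBond (F.P n) 0) :
    dbarTwS F n K h U₀ (fun b => Complex.I • X b) c ∈ specialUnitaryUnits (Fin 2) :=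
  dbarTwS_mem_specialUnitaryUnits_of_frames F h hε₀ (windows_of_numerals F hε₀.le he hWe hWε).2.1 hε₁ hε₁' hU₀ hX hU₁
    (fun y => frameTwS_mem_specialUnitaryUnits_of_regPr F h hε₀ he hWε hWe U₀ hU₀ X (fun b => (hX b).1) (fun b => (hX b).2) hXe y) c

/-- ★★ **HENCE THE TWISTED LOG-CHART OF THE KNIT'S EXPONENT IS `𝔰𝔲(2)`-VALUED**: `(log U̿ˢ(iX)(c))* = −log U̿ˢ(iX)(c)` and `tr log U̿ˢ(iX)(c) = 0` at `U₀ ∈ 𝔘_k(ε₀)`, `e^{iX}U₀ ∈ 𝔘_k(ε₁)`,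
`X` Hermitian traceless with `‖X(b)‖ ≤ e·η` — no displayed `SU(2)` letter left. [cite: Balaban1985Variational, (51) p.286; Balaban1985BackgroundPropagators, (3.13)–(3.14) p.393] -/
theorem logChartTwS_skewHermitian_of_regPr₂ {ε₀ ε₁ e : ℝ} (hε₀ : 0 < ε₀) (he : 0 ≤ e) (hWe : 10 ^ 9 * (F.L : ℝ) ^ 2 * e ≤ 1) (hWε : 10 ^ 12 * (F.L : ℝ) ^ 3 * ε₀ ≤ 1)
    (hε₁ : 0 < ε₁) (hε₁' : 10 ^ 7 * (F.L : ℝ) ^ 3 * ε₁ ≤ 1)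
    {U₀ : GaugeField (F.P K) 0 (Matrix.specialUnitaryGroup (Fin 2) ℂ)} (hU₀ : RegPr F n K ε₀ U₀)
    {X : PBond (F.P K) 0 → Matrix (Fin 2) (Fin 2) ℂ} (hX : ∀ b : PBond (F.P K) 0, (X b).IsHermitian ∧ Matrix.trace (X b) = 0) (hXe : ∀ b, ‖X b‖ ≤ e * eta F n K)
    (hU₁ : RegPr F n K ε₁ (emb15 U₀ (expHermField X))) (c : PBond (F.P n) 0) :
    star (logChartTwS F n K h U₀ (fun b => Complex.I • X b) c) = -logChartTwS F n K h U₀ (fun b => Complex.I • X b) c ∧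
      (logChartTwS F n K h U₀ (fun b => Complex.I • X b) c).trace = 0 :=
  logChartTwS_skewHermitian_of_ball F h hε₀ he hWe hWε U₀ hU₀ (fun b => Complex.I • X b) (fun b => by rw [norm_smul, Complex.norm_I, one_mul]; exact hXe b)
    (dbarTwS_mem_specialUnitaryUnits_of_regPr₂ F h hε₀ he hWe hWε hε₁ hε₁' hU₀ hX hXe hU₁) c

/-! ## §4 Print's (51) for the S chart: the chart exponent `A′ − H D(A′)` is real for real `A′` -/

/-- ★★★ **«FOR A′ WITH VALUES IN 𝔤 THE CONFIGURATION D(A′) HAS VALUES IN 𝔤» FOR THE RE-BASED TWISTED CHART** (`C := CmapTwS U₀ = logChartTwS U₀ − QTwS U₀`, print's `D = Dfix C H C₂`):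
for any closed real data space `S′ ⊇ {𝔰𝔲(2)-valued data}`, any real field space `S` (its `𝔰𝔲(2)`-valuedness enters only through the supplier of `hSUball`), any `ℂ`-linear `H` with
`H(S′) ⊆ S` and `‖HX‖ ≤ b‖X‖`, in the regime
`QuadAnalytic (CmapTwS U₀) C₂ R`, `R ≤ e·η`, `9C₂bε < 1`, `3ε ≤ R` (`U₀ ∈ 𝔘_k(ε₀)`, `10⁹L²e ≤ 1`, `10¹²L³ε₀ ≤ 1`), and under the DISPLAYED tower clause `hSUball` («`U̿ˢ(A)(c) ∈ SU(2)`
for real `A` in the ball»): every `A′ ∈ S` with `‖A′‖ < ε` has `Dfix (CmapTwS U₀) H C₂ A′ ∈ S′` and `A′ − H(Dfix (CmapTwS U₀) H C₂ A′) ∈ S`.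
[cite: Balaban1985Variational, (47)–(51) pp.285–286, (55) p.286, Prop. 3 p.289, (112) p.294; Balaban1985BackgroundPropagators, (3.13)–(3.14) p.393] -/
theorem chartExponentTwS_mem_of_ball {ε₀ e : ℝ} (hε₀ : 0 < ε₀) (he : 0 < e) (hWe : 10 ^ 9 * (F.L : ℝ) ^ 2 * e ≤ 1) (hWε : 10 ^ 12 * (F.L : ℝ) ^ 3 * ε₀ ≤ 1)
    (U₀ : GaugeField (F.P K) 0 (Matrix.specialUnitaryGroup (Fin 2) ℂ)) (hreg : RegPr F n K ε₀ U₀)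
    (S : Submodule ℝ (PBond (F.P K) 0 → Matrix (Fin 2) (Fin 2) ℂ)) (S' : Submodule ℝ (PBond (F.P n) 0 → Matrix (Fin 2) (Fin 2) ℂ)) (hS'c : IsClosed (S' : Set (PBond (F.P n) 0 → Matrix (Fin 2) (Fin 2) ℂ)))
    (hS' : ∀ Y : PBond (F.P n) 0 → Matrix (Fin 2) (Fin 2) ℂ, (∀ c, star (Y c) = -Y c ∧ (Y c).trace = 0) → Y ∈ S')
    {R : ℝ} (hRe : R ≤ e * eta F n K)
    (hSUball : ∀ A ∈ S, ‖A‖ < R → ∀ c : PBond (F.P n) 0, dbarTwS F n K h U₀ A c ∈ specialUnitaryUnits (Fin 2))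
    {H : (PBond (F.P n) 0 → Matrix (Fin 2) (Fin 2) ℂ) →ₗ[ℂ] (PBond (F.P K) 0 → Matrix (Fin 2) (Fin 2) ℂ)} (hH : ∀ X ∈ S', H X ∈ S)
    {C₂ b ε : ℝ} (hC : QuadAnalytic (CmapTwS F n K h U₀) C₂ R) (hC₂ : 0 ≤ C₂) (hb : 0 ≤ b) (hHop : ∀ X, ‖H X‖ ≤ b * ‖X‖)
    (hq : 9 * C₂ * b * ε < 1) (hRC : 3 * ε ≤ R) {A' : PBond (F.P K) 0 → Matrix (Fin 2) (Fin 2) ℂ} (hA'ε : ‖A'‖ < ε) (hA' : A' ∈ S) :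
    Dfix (CmapTwS F n K h U₀) H C₂ A' ∈ S' ∧ A' - H (Dfix (CmapTwS F n K h U₀) H C₂ A') ∈ S := by
  -- the chart is differentiable at `0` with derivative `QTwS U₀` (W5), and vanishes there
  have hf : HasFDerivAt (logChartTwS F n K h U₀) (QTwS F n K h U₀) 0 := by
    rw [QTwS_def]
    have h0 : (0 : PBond (F.P K) 0 → Matrix (Fin 2) (Fin 2) ℂ) ∈ ball (0 : PBond (F.P K) 0 → Matrix (Fin 2) (Fin 2) ℂ) (e * eta F n K) :=
      mem_ball_self (mul_pos he (eta_pos F n K))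
    exact ((analyticOnNhd_logChartTwS F h hε₀ he hWe hWε U₀ hreg) 0 h0).differentiableAt.hasFDerivAt
  have hf0 : logChartTwS F n K h U₀ 0 = 0 := logChartTwS_zero U₀
  -- reality of the chart on the ball `‖y‖ < R ≤ e·η`
  have hmaps : ∀ y ∈ S, ‖y‖ < R → logChartTwS F n K h U₀ y ∈ S' := fun y hy hyR =>
    hS' _ fun c => logChartTwS_skewHermitian_of_ball F h hε₀ he.le hWe hWε U₀ hreg y
      (fun b => (norm_le_pi_norm y b).trans (hyR.le.trans hRe)) (hSUball y hy hyR) c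
  have hCeq : (fun A => logChartTwS F n K h U₀ A - QTwS F n K h U₀ A) = CmapTwS F n K h U₀ := rfl
  have hC' : QuadAnalytic (fun A => logChartTwS F n K h U₀ A - QTwS F n K h U₀ A) C₂ R := by rw [hCeq]; exact hC
  have key := chartExponent_mem_of_mapsTo_of_ball hf hf0 S S' hS'c hH hmaps hC' hC₂ hb hHop hq hRC hA'ε hA'
  rw [hCeq] at key
  exact key


/-! ## §5 (v1.1) THE TOWER CLAUSE SUPPLIED — NO DISPLAYED `SU(2)` LETTER (★w3-20520 g4's `Prop7SymFrameBound.dbarTwS_mem_specialUnitaryUnits_of_regPr`) -/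

section Supplied

open Summit.QuantumFields.YangMills.Theorems.Prop7SymFrameBound (dbarTwS_mem_specialUnitaryUnits_of_regPr)

/-- ★★ **`hSUball` DISCHARGED**: at `U₀ ∈ 𝔘_k(ε₀)` (`10⁹L²e ≤ 1`, `10¹²L³ε₀ ≤ 1`), for every `𝔰𝔲(2)`-valued fine field `A` with `‖A‖ < R ≤ e·η` and every comparison bond `c`,
`U̿ˢ(A)(c) ∈ SU(2)` — ★w3-20520 g4's tower clause (the re-based twisted average of `SU(2)` data is `SU(2)`-valued: both towers and the symmetric frames are, level by level, by
`eml_mem_specialUnitaryGroup` inside W2's windows) read at `X := −i·A` (self-adjoint, traceless, `‖X(b)‖ = ‖A(b)‖ ≤ ‖A‖`).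
[cite: Balaban1987RG1, (0.9) p.253; Balaban1985Averaging, (89)–(92) p.31, (97) p.32] -/
theorem dbarTwS_mem_specialUnitaryUnits_of_skewHermitian {ε₀ e : ℝ} (hε₀ : 0 < ε₀) (he : 0 ≤ e) (hWe : 10 ^ 9 * (F.L : ℝ) ^ 2 * e ≤ 1) (hWε : 10 ^ 12 * (F.L : ℝ) ^ 3 * ε₀ ≤ 1)
    (U₀ : GaugeField (F.P K) 0 (Matrix.specialUnitaryGroup (Fin 2) ℂ)) (hreg : RegPr F n K ε₀ U₀)
    (A : PBond (F.P K) 0 → Matrix (Fin 2) (Fin 2) ℂ) (hA : ∀ b : PBond (F.P K) 0, star (A b) = -A b ∧ (A b).trace = 0) (hAe : ∀ b, ‖A b‖ ≤ e * eta F n K)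
    (c : PBond (F.P n) 0) : dbarTwS F n K h U₀ A c ∈ specialUnitaryUnits (Fin 2) := by
  have hIX : (fun b => Complex.I • ((-Complex.I) • A b)) = A := funext fun b => by
    rw [smul_smul, mul_neg, Complex.I_mul_I, neg_neg, one_smul]
  have hXsa : ∀ b, IsSelfAdjoint ((-Complex.I) • A b) := fun b => by
    rw [IsSelfAdjoint, star_smul, (hA b).1, star_neg, Complex.star_def, Complex.conj_I, neg_neg, smul_neg, neg_smul]
  have hXtr : ∀ b, Matrix.trace ((-Complex.I) • A b) = 0 := fun b => by rw [Matrix.trace_smul, (hA b).2, smul_zero]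
  have hXn : ∀ b, ‖(-Complex.I) • A b‖ ≤ e * eta F n K := fun b => by rw [norm_smul, norm_neg, Complex.norm_I, one_mul]; exact hAe b
  have key := dbarTwS_mem_specialUnitaryUnits_of_regPr F h hε₀ he hWε hWe U₀ hreg (fun b => (-Complex.I) • A b) hXsa hXtr hXn c
  rwa [hIX] at key

/-- ★★★ **PRINT'S (51) FOR THE RE-BASED TWISTED CHART, NO `SU(2)` DISPLAY**: as `chartExponentTwS_mem_of_ball`, the tower clause `hSUball` now SUPPLIED for every real field space
`S` of `𝔰𝔲(2)`-valued fields (`hS`) — for any closed real data space `S′ ⊇ {𝔰𝔲(2)-valued data}`, any `ℂ`-linear `H` with `H(S′) ⊆ S`, `‖HX‖ ≤ b‖X‖`, in the regime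
`QuadAnalytic (CmapTwS U₀) C₂ R`, `R ≤ e·η`, `9C₂bε < 1`, `3ε ≤ R`, at `U₀ ∈ 𝔘_k(ε₀)` with `10⁹L²e ≤ 1`, `10¹²L³ε₀ ≤ 1`: every `A′ ∈ S` with `‖A′‖ < ε` has
`Dfix (CmapTwS U₀) H C₂ A′ ∈ S′` and `A′ − H(Dfix (CmapTwS U₀) H C₂ A′) ∈ S`.  The only displayed letter left is the reality `hH` of the opaque `H` (N06 ∕ L0d).
[cite: Balaban1985Variational, (47)–(51) pp.285–286, (55) p.286, Prop. 3 p.289, (112) p.294; Balaban1985BackgroundPropagators, (3.13)–(3.14) p.393; Balaban1987RG1, (0.9) p.253] -/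
theorem chartExponentTwS_mem_of_ball_of_regPr {ε₀ e : ℝ} (hε₀ : 0 < ε₀) (he : 0 < e) (hWe : 10 ^ 9 * (F.L : ℝ) ^ 2 * e ≤ 1) (hWε : 10 ^ 12 * (F.L : ℝ) ^ 3 * ε₀ ≤ 1)
    (U₀ : GaugeField (F.P K) 0 (Matrix.specialUnitaryGroup (Fin 2) ℂ)) (hreg : RegPr F n K ε₀ U₀)
    (S : Submodule ℝ (PBond (F.P K) 0 → Matrix (Fin 2) (Fin 2) ℂ)) (S' : Submodule ℝ (PBond (F.P n) 0 → Matrix (Fin 2) (Fin 2) ℂ)) (hS'c : IsClosed (S' : Set (PBond (F.P n) 0 → Matrix (Fin 2) (Fin 2) ℂ)))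
    (hS : ∀ A ∈ S, ∀ b : PBond (F.P K) 0, star (A b) = -A b ∧ (A b).trace = 0)
    (hS' : ∀ Y : PBond (F.P n) 0 → Matrix (Fin 2) (Fin 2) ℂ, (∀ c, star (Y c) = -Y c ∧ (Y c).trace = 0) → Y ∈ S')
    {R : ℝ} (hRe : R ≤ e * eta F n K)
    {H : (PBond (F.P n) 0 → Matrix (Fin 2) (Fin 2) ℂ) →ₗ[ℂ] (PBond (F.P K) 0 → Matrix (Fin 2) (Fin 2) ℂ)} (hH : ∀ X ∈ S', H X ∈ S)
    {C₂ b ε : ℝ} (hC : QuadAnalytic (CmapTwS F n K h U₀) C₂ R) (hC₂ : 0 ≤ C₂) (hb : 0 ≤ b) (hHop : ∀ X, ‖H X‖ ≤ b * ‖X‖)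
    (hq : 9 * C₂ * b * ε < 1) (hRC : 3 * ε ≤ R) {A' : PBond (F.P K) 0 → Matrix (Fin 2) (Fin 2) ℂ} (hA'ε : ‖A'‖ < ε) (hA' : A' ∈ S) :
    Dfix (CmapTwS F n K h U₀) H C₂ A' ∈ S' ∧ A' - H (Dfix (CmapTwS F n K h U₀) H C₂ A') ∈ S :=
  chartExponentTwS_mem_of_ball F h hε₀ he hWe hWε U₀ hreg S S' hS'c hS' hRe
    (fun A hA hAR c => dbarTwS_mem_specialUnitaryUnits_of_skewHermitian F h hε₀ he.le hWe hWε U₀ hreg A (hS A hA)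
      (fun b' => (norm_le_pi_norm A b').trans (hAR.le.trans hRe)) c)
    hH hC hC₂ hb hHop hq hRC hA'ε hA'
 
end Supplied

end Summit.QuantumFields.YangMills.Theorems.Prop7ChartRealityTwS

end
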